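import Literature.MathematicalPhysics.QuantumFieldTheory.YangMillsOS
import Literature.MathematicalPhysics.QuantumLattice.LatticeGaugeDLRGibbsProofs
import Summits.QuantumFields.YangMills.Theses.CertificationLength
import Summits.QuantumFields.YangMills.Theorems.ConvexGribovBodyNonSimplyConnectedLatticeGapStubBoxInfluenceDecayAtOfCellFiniteSize
import Summits.QuantumFields.YangMills.Theorems.ConvexGribovBodyNonSimplyConnectedLatticeGapStubGaugeInvariantUniqueness

/-!
# `stub_translationInvariantUniqueness` (U_tr): translation-invariant uniqueness on the gauge-invariant
# algebra at weak coupling — AUDIT FILE (stub of crux `FibreToTorus`, stmt-QuantumFields-16244, line `Sketch`)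

U_tr: for every compact simple `G` and faithful unitary `r` there is `β_u` such that at every `β ≥ β_u` any two
`ℤ⁴`-translation-invariant DLR states of `ymSpecification r.ρ β` agree on every `YMSpecies G`.

This file records (kernel-checked):
* `translationInvariantUniqueness_of_gaugeInvariantUniqueness` — U_tr ≤ U (line `uniqueness`'s stub
  `GaugeInvariantUniqueness`: ALL DLR states agree on `YMSpecies` at `β ≥ β_u`): drop the two invariance hypotheses.
* `translationInvariantUniqueness_of_completeAnalyticityAtLargeScales` — U_tr ≤ CA (item stmt-QuantumFields-16178,
  `CertificationLength.CompleteAnalyticityAtLargeScales`), via the landed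
  `stub_boxInfluenceDecayAt_of_cellFiniteSize` (p130046) and `stub_gaugeInvariantUniqueness_of_boxInfluenceDecay`
  (p129742).  Axiom closure of the composite: propext, Classical.choice, Quot.sound.

Audit (worker, 2026-08-17): verdict `stub-blocked: CertificationLength.CompleteAnalyticityAtLargeScales`.
* No engine in the tree for large `β` other than item 16178 (which proves the target `UniformLatticeGap` outright,
  `uniformLatticeGap_of_completeAnalyticityAtLargeScales`); no Theses item mentions `IsZdTranslationInvariant`;
  `HasUniqueInfiniteVolumeLimit` / `HasUniqueGibbsMeasure (ymSpecification …)` facts are strong-coupling only.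
  Israel's tangent form (unique tangent to the pressure at `βΦ_Wilson` in gauge-invariant local directions) has no
  tree interface beyond `convexOn_torusLogPartition` / `exists_hasFreeEnergyDensity_holds` (convexity gives
  differentiability off a countable set of `β`, in the energy direction only — not the stub).
* Not vacuous: `ymGibbsMeasures r.ρ β ≠ ∅` (`infiniteVolumeLimitPoints_nonempty_holds` +
  `mem_ymGibbsMeasures_of_mem_infiniteVolumeLimitPoints_holds`; `T2Space`/`SecondCountableTopology G` from `r`),
  translation-invariant members by stub TI; `IsGibbsMeasure` carries `IsProbabilityMeasure` (zero measure excluded);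
  DLR states are gauge invariant (`stub_dlr_gaugeInvariant`), so gauge images give nothing; `G` connected non-abelian,
  `r` faithful ⇒ `r.N ≥ 2`, unique classical vacuum `U_p = 1`.
* No cheap refutation / misstatement found: hypercubic images (90° rotations, reflections, `U ↦ U⁻¹`) of a
  translation-invariant DLR state are translation-invariant DLR states, so U_tr forces hypercubic symmetry of every
  such state at `β ≥ β_u` — believed, unproved, no known counterexample for connected simple `G` in `d = 4`; bulk /
  Bhanot–Creutz first-order points (reducible faithful `r` allowed by `LatticeRep`) sit at `β = O(1)` on every ray and
  are absorbed by `∃ β_u`.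
-/

noncomputable section

open scoped BigOperators Topology
open Filter Function MeasureTheory
open Literature.MathematicalPhysics.QuantumFieldTheory
open Literature.MathematicalPhysics.QuantumLattice (LGConfig ZdEdge configShift ymGibbsMeasures
  IsZdTranslationInvariant LocalGaugeObservable ymSpecification IsCylinder)

namespace Summit.QuantumFields.YangMills.Theorems.FibreToTorus

/-- **U ⇒ U_tr** (pure logic): uniqueness on the gauge-invariant algebra among ALL DLR states implies it among the
translation-invariant ones. The hypothesis is line `uniqueness`'s `GaugeInvariantUniqueness`, verbatim. -/
theorem translationInvariantUniqueness_of_gaugeInvariantUniqueness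
    (hU : ∀ (G : Type) [Group G] [TopologicalSpace G] [IsTopologicalGroup G] [CompactSpace G]
      [MeasurableSpace G] [BorelSpace G], IsCompactSimpleLieGroup G → ∀ r : LatticeRep G,
      ∃ βu : ℝ, ∀ β : ℝ, βu ≤ β → ∀ μ ν : MeasureTheory.Measure (LGConfig 4 G),
        μ ∈ ymGibbsMeasures (d := 4) r.ρ β → ν ∈ ymGibbsMeasures (d := 4) r.ρ β →
          ∀ A : YMSpecies G, ∫ U, A.F U ∂μ = ∫ U, A.F U ∂ν) :
    ∀ (G : Type) [Group G] [TopologicalSpace G] [IsTopologicalGroup G] [CompactSpace G]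
      [MeasurableSpace G] [BorelSpace G], IsCompactSimpleLieGroup G → ∀ r : LatticeRep G,
      ∃ βu : ℝ, ∀ β : ℝ, βu ≤ β → ∀ μ ν : MeasureTheory.Measure (LGConfig 4 G),
        μ ∈ ymGibbsMeasures (d := 4) r.ρ β → ν ∈ ymGibbsMeasures (d := 4) r.ρ β →
        IsZdTranslationInvariant μ → IsZdTranslationInvariant ν →
          ∀ A : YMSpecies G, ∫ U, A.F U ∂μ = ∫ U, A.F U ∂ν := by
  intro G _ _ _ _ _ _ hG r
  obtain ⟨βu, h⟩ := hU G hG r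
  exact ⟨βu, fun β hβ μ ν hμ hν _ _ A => h β hβ μ ν hμ hν A⟩

open Summit.QuantumFields.YangMills.Theorems.NonSimplyConnectedLatticeGap in
/-- **CA ⇒ U** at fixed large `β`: the Dobrushin–Shlosman finite-size condition at arbitrarily large scales
(item stmt-QuantumFields-16178) gives exponential decay of the cube influence of exterior data on every
gauge-invariant local observable (p130046), hence agreement of all DLR states on them (p129742). -/
theorem gaugeInvariantUniqueness_of_completeAnalyticityAtLargeScales
    (h : Summit.QuantumFields.YangMills.Theses.CertificationLength.CompleteAnalyticityAtLargeScales) :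
    ∀ (G : Type) [Group G] [TopologicalSpace G] [IsTopologicalGroup G] [CompactSpace G]
      [MeasurableSpace G] [BorelSpace G], IsCompactSimpleLieGroup G → ∀ r : LatticeRep G,
      ∃ βu : ℝ, ∀ β : ℝ, βu ≤ β → ∀ μ ν : MeasureTheory.Measure (LGConfig 4 G),
        μ ∈ ymGibbsMeasures (d := 4) r.ρ β → ν ∈ ymGibbsMeasures (d := 4) r.ρ β →
          ∀ A : YMSpecies G, ∫ U, A.F U ∂μ = ∫ U, A.F U ∂ν := by
  intro G _ _ _ _ iM iB hG r
  have hM : iM = borel G := BorelSpace.measurable_eq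
  subst hM
  letI : MeasurableSpace G := borel G
  haveI : T2Space G := (r.continuous.isClosedEmbedding r.injective).isEmbedding.t2Space
  haveI : SecondCountableTopology G :=
    (r.continuous.isClosedEmbedding r.injective).isEmbedding.secondCountableTopology
  obtain ⟨n, ε, hn, hε, hεM, hB⟩ := h G hG r
  obtain ⟨β₂, hβ₂⟩ := hB 1
  refine ⟨β₂, fun β hβ μ ν hμ hν A => ?_⟩
  obtain ⟨b, -, hb1, hTV⟩ := hβ₂ β hβ
  obtain ⟨m, hm, hdec⟩ :=
    stub_boxInfluenceDecayAt_of_cellFiniteSize G r.N r.ρ r.continuous β n ε b hn hε hεM hb1 hTV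
  exact stub_gaugeInvariantUniqueness_of_boxInfluenceDecay G r.N r.ρ r.continuous β m hm hdec μ ν hμ hν A

/-- **CA ⇒ U_tr**: composite of the two lemmas above. -/
theorem translationInvariantUniqueness_of_completeAnalyticityAtLargeScales :
    Summit.QuantumFields.YangMills.Theses.CertificationLength.CompleteAnalyticityAtLargeScales →
    ∀ (G : Type) [Group G] [TopologicalSpace G] [IsTopologicalGroup G] [CompactSpace G]
      [MeasurableSpace G] [BorelSpace G], IsCompactSimpleLieGroup G → ∀ r : LatticeRep G,
      ∃ βu : ℝ, ∀ β : ℝ, βu ≤ β → ∀ μ ν : MeasureTheory.Measure (LGConfig 4 G),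
        μ ∈ ymGibbsMeasures (d := 4) r.ρ β → ν ∈ ymGibbsMeasures (d := 4) r.ρ β →
        IsZdTranslationInvariant μ → IsZdTranslationInvariant ν →
          ∀ A : YMSpecies G, ∫ U, A.F U ∂μ = ∫ U, A.F U ∂ν := fun h =>
  translationInvariantUniqueness_of_gaugeInvariantUniqueness
    (gaugeInvariantUniqueness_of_completeAnalyticityAtLargeScales h)


end Summit.QuantumFields.YangMills.Theorems.FibreToTorus

end
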